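import Literature.NumberTheory.EllipticCurves.IwasawaSelmerSupersingularLocalProofs
import Literature.NumberTheory.EllipticCurves.GoodReductionLangLift
import Literature.NumberTheory.EllipticCurves.UnramifiedCoboundaryInputs
import Literature.NumberTheory.EllipticCurves.ReductionInertiaInvarianceProofs
import Mathlib.Data.Nat.Factorization.Basic
import Mathlib.FieldTheory.Finite.Basic
import HarnessLib

/-!
# Kummer classes at `v ∣ p` modulo the kernel of reduction: the torsion-coboundary congruence and the uniform
# exponent from finitely many `E₁`-cosets (Greenberg, LNM 1716, §2; theorems only)

`Proofs` file (THEOREMS ONLY: no definition, no named fact, no instance, no `sorry`) in topic `NumberTheory/EllipticCurves`,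
in the local currency of `IwasawaSelmerSupersingularLocalProofs`: `K` a number field, `v` a finite place, `K_v = v.adicCompletion K`,
`E(K̄_v) = localPoints W K_v` with its `Γ_{K_v}`-action, the spectral valuation `|·|_v = v.spectralValuation`, the kernel of
reduction `E₁ = E₁(K̄_v) = W.localKernelOfReduction v` (Silverman *AEC* VII.2; Greenberg's `𝓕(𝔪̄)`), and — at a place of GOOD
reduction — the reduction homomorphism `red : E(K̄_v) → Ẽ(k₀)` of the spectral model (`goodReductionHom (W.localSpectralModel v)`
along `localPointsEquivSpectralModel`; `k₀ = 𝒪_w/𝔪_w`, an algebraic closure of `k_v`), whose kernel is `E₁`.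

The purpose is the `v ∣ p` clause of Howard's Selmer compatibility of the compact control map (Howard, *Compos. Math.* 140 (2004),
Lemma 2.2.7 / Prop. 2.2.8: the image of `𝔖 = lim H¹(K_n, T)` lies in `H¹_{F_𝔮}`, whose condition at `v ∣ p` is the saturated STRICT
ORDINARY condition `ker (H¹(K_v, W_k) → H¹(K_v, W_k/Fil_v W_k))`), i.e. Greenberg's computation (LNM 1716, §2, Props. 2.2 and 2.4):
*the image of a Kummer class `δ(P)`, `P ∈ E(L)`, `L/K_v` finite, in `H¹(L, E[p^k]/Fil_v) ⊆ H¹(L, Ẽ[p^k])` is the Kummer class of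
`P̃ ∈ Ẽ(k_L)`, which is killed by the exponent of the finite group `Ẽ(k_L)(p)`*. Here, place by place in `E(K̄_v)`:

* §1 `AddSubgroup.exists_nsmul_sub_mem_of_finset` — abstract: if a subgroup `Q ⊇ E₁` meets only the `E₁`-cosets of a finite set `T`,
  then `p^{#T} Q ⊆ p^k Q + E₁` for every `k` (Lagrange in the finite group `Q/E₁`, whose order has `p`-part `< #T`, and Bézout).
* §2 `WeierstrassCurve.exists_torsion_sub_coboundary_mem_localKernelOfReduction` (**the torsion-coboundary congruence**): for
  `H ≤ Γ_{K_v}`, if `E₁` is `p^k`-divisible (good ordinary reduction, file `LocalPointsOrdinaryKernelDivisibleProofs`) and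
  `p^a (E(K̄_v)/E₁)^H ⊆ p^k (E(K̄_v)/E₁)^H`, then for every `P` with `p^k P` fixed by `H` there is a `p^k`-TORSION point `y` with
  `σ(p^a P) − p^a P ≡ σ y − y (mod E₁)` for all `σ ∈ H` — the cocycle of `p^a • δ(p^k P)` is a coboundary modulo `Fil_v`.
* §3 (good reduction) `WeierstrassCurve.localRed_eq_zero_iff` (`ker red = E₁`), `localRed_smul_of_mem_absInertia` (inertia acts
  trivially on `Ẽ(k₀)`, *AEC* VIII §1), `smul_sub_mem_localKernelOfReduction_of_mem_absInertia` (`τ P − P ∈ E₁` for `τ ∈ I_{K_v}`).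
* §4 `WeierstrassCurve.exists_finset_sub_mem_localKernelOfReduction_of_isArithFrobAt_pow` (**finiteness**): for an arithmetic
  Frobenius `σ₀ ∈ Γ_{K_v}` and `N₀ ≥ 1`, the points `R ∈ E(K̄_v)` with `σ₀^{N₀} R ≡ R (mod E₁)` lie in finitely many `E₁`-cosets
  (their reductions have coordinates in the roots of `X^{q^{N₀}} − X` in `k₀`, i.e. lie in `Ẽ(𝔽_{q^{N₀}})`).

References: R. Greenberg, *Iwasawa theory for elliptic curves*, LNM 1716 (1999), §2 (Props. 2.1, 2.2, 2.4; pp. 70–73); J. H. Silverman,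
*The Arithmetic of Elliptic Curves* (2009), VII.2.1–2.2, VIII §1; B. Howard, *Compos. Math.* 140 (2004), §2.2, §3.1 (`H¹_ord`).
No summit statement is proved here; BSD is not proved by any of this.
-/

noncomputable section

open scoped Classical NNReal
open NumberField IsDedekindDomain Field Polynomial

universe u

/-! ## §1 Finitely many `E₁`-cosets ⇒ a uniform power of `p` pushes `Q` into `p^k Q + E₁` -/

namespace AddSubgroup

variable {G : Type*} [AddCommGroup G]

/-- **Lagrange + Bézout in `Q/(Q ∩ E₁)`.** Let `E₁, Q ≤ G` be subgroups of an abelian group and `T` a finite set such that every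
`R ∈ Q` has `R − t ∈ E₁` for some `t ∈ T`. Then `Q/E₁` is a finite group of order `n ≤ #T`, the `p`-part `p^c` of `n` has
`c < #T`, and for every `k` and every `R ∈ Q` there is `S ∈ Q` with `p^k S − p^{#T} R ∈ E₁` (`n R̄ = 0`, `n = p^c u`, `p ∤ u`,
Bézout for `p^k` and `u`). [cite: GreenbergLNM1716, §2 Prop. 2.1 and Prop. 2.2 (the Kummer image at `v ∣ p` is killed by `#Ẽ(k_v)(p)`)] -/
theorem exists_nsmul_sub_mem_of_finset (E₁ Q : AddSubgroup G) (T : Finset G)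
    (hT : ∀ R ∈ Q, ∃ t ∈ T, R - t ∈ E₁) {p : ℕ} (hp : p.Prime) (k : ℕ) {R : G} (hR : R ∈ Q) :
    ∃ S ∈ Q, p ^ k • S - p ^ T.card • R ∈ E₁ := by
  -- the finite quotient `A = Q / E₁`
  let A := Q ⧸ E₁.addSubgroupOf Q
  have hmk : ∀ x y : Q, (QuotientAddGroup.mk x : A) = QuotientAddGroup.mk y ↔ (x : G) - y ∈ E₁ := by
    intro x y
    rw [QuotientAddGroup.eq, AddSubgroup.mem_addSubgroupOf, AddSubgroup.coe_add, AddSubgroup.coe_neg,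
      neg_add_eq_sub]
    exact ⟨fun h ↦ by simpa using E₁.neg_mem h, fun h ↦ by simpa using E₁.neg_mem h⟩
  -- representatives: an injection `A ↪ T`
  have hrep : ∀ x : A, ∃ t ∈ T, ∀ y : Q, (QuotientAddGroup.mk y : A) = x → (y : G) - t ∈ E₁ := by
    intro x
    obtain ⟨y₀, rfl⟩ := QuotientAddGroup.mk_surjective x
    obtain ⟨t, ht, hyt⟩ := hT y₀ y₀.2
    refine ⟨t, ht, fun y hy ↦ ?_⟩
    have h := (hmk y y₀).mp hy
    have : (y : G) - t = ((y : G) - y₀) + ((y₀ : G) - t) := by abel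
    rw [this]
    exact E₁.add_mem h hyt
  choose rep hrepT hrep using hrep
  have hinj : Function.Injective rep := by
    intro x x' hxx'
    obtain ⟨y, rfl⟩ := QuotientAddGroup.mk_surjective x
    obtain ⟨y', rfl⟩ := QuotientAddGroup.mk_surjective x'
    rw [hmk]
    have h1 := hrep _ y rfl
    have h2 := hrep _ y' rfl
    rw [hxx'] at h1
    have : (y : G) - y' = ((y : G) - rep (QuotientAddGroup.mk y')) - ((y' : G) - rep (QuotientAddGroup.mk y')) := by abel
    rw [this]
    exact E₁.sub_mem h1 h2
  haveI : Finite A := Finite.of_injective (fun x ↦ (⟨rep x, hrepT x⟩ : T)) fun x x' h ↦ hinj (Subtype.ext_iff.mp h)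
  have hcardA : Nat.card A ≤ T.card := by
    have h := Nat.card_le_card_of_injective (fun x ↦ (⟨rep x, hrepT x⟩ : T)) fun x x' h ↦ hinj (Subtype.ext_iff.mp h)
    rwa [Nat.card_eq_finsetCard] at h
  -- `n • R ∈ E₁`, `n = #A = p^c u`, `p ∤ u`, `c < n ≤ #T`
  set n : ℕ := Nat.card A with hn
  have hn0 : n ≠ 0 := Nat.card_pos.ne'
  have hnR : n • R ∈ E₁ := by
    have h1 : n • (QuotientAddGroup.mk (⟨R, hR⟩ : Q) : A) = 0 := by
      rw [hn, ← addOrderOf_dvd_iff_nsmul_eq_zero]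
      exact _root_.addOrderOf_dvd_natCard _
    rw [← QuotientAddGroup.mk_nsmul, QuotientAddGroup.eq_zero_iff, AddSubgroup.mem_addSubgroupOf,
      AddSubgroup.coe_nsmul] at h1
    exact h1
  set c : ℕ := n.factorization p with hc
  set u : ℕ := n / p ^ c with hu
  have hncu : p ^ c * u = n := Nat.ordProj_mul_ordCompl_eq_self n p
  have hpu : Nat.Coprime p u := Nat.coprime_ordCompl hp hn0
  have hcT : c ≤ T.card := (Nat.factorization_lt p hn0).le.trans hcardA
  have hcop : IsCoprime ((p : ℤ) ^ k) (u : ℤ) := by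
    rw [← Nat.cast_pow, Nat.isCoprime_iff_coprime]
    exact Nat.Coprime.pow_left k hpu
  obtain ⟨α, β, hαβ⟩ := hcop
  -- the witness `S = (p^{#T-c} α p^c) • R`
  refine ⟨((p : ℤ) ^ (T.card - c) * α * (p : ℤ) ^ c) • R, Q.zsmul_mem hR _, ?_⟩
  have hTc : ((p : ℤ) ^ T.card) = (p : ℤ) ^ (T.card - c) * (p : ℤ) ^ c := by
    rw [← pow_add, Nat.sub_add_cancel hcT]
  have hint : ((p : ℤ) ^ k * ((p : ℤ) ^ (T.card - c) * α * (p : ℤ) ^ c) - (p : ℤ) ^ T.card) =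
      (-(β * (p : ℤ) ^ (T.card - c))) * (n : ℤ) := by
    rw [hTc, ← hncu]
    push_cast
    linear_combination ((p : ℤ) ^ (T.card - c) * (p : ℤ) ^ c) * hαβ
  have hcalc : p ^ k • (((p : ℤ) ^ (T.card - c) * α * (p : ℤ) ^ c) • R) - p ^ T.card • R =
      (-(β * (p : ℤ) ^ (T.card - c))) • (n • R) := by
    rw [← natCast_zsmul, ← natCast_zsmul R (p ^ T.card), ← natCast_zsmul R n, smul_smul, smul_smul, ← sub_smul,
      Nat.cast_pow, Nat.cast_pow, hint]
  rw [hcalc]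
  exact E₁.zsmul_mem hnR _

end AddSubgroup

/-! ## §2 The torsion-coboundary congruence modulo `E₁` -/

namespace WeierstrassCurve

open Literature.NumberTheory.EllipticCurves Literature.NumberTheory.GaloisRepresentations Field
  IsDedekindDomain.HeightOneSpectrum

variable {K : Type u} [Field K] [NumberField K] (W : WeierstrassCurve K) (v : HeightOneSpectrum (𝓞 K))

/-- **The torsion-coboundary congruence** (Greenberg, LNM 1716, §2, proof of Prop. 2.2: the Kummer class of `P ∈ E(L)` maps in
`H¹(L, Ẽ[p^∞])` to the Kummer class of `P̃ ∈ Ẽ(k_L)`, killed by the `p`-part of `#Ẽ(k_L)`). Let `H ≤ Γ_{K_v}`, `E₁ = E₁(K̄_v)`,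
and suppose: (div₁) `E₁` is `p^k`-divisible; (div_H) for every `R` with `σR ≡ R (mod E₁)` for all `σ ∈ H` there is `S` with the
same property and `p^k S ≡ p^a R (mod E₁)` (i.e. `p^a (E/E₁)^H ⊆ p^k (E/E₁)^H`). Then for every `P ∈ E(K̄_v)` with `p^k P`
fixed by `H` there is a `p^k`-TORSION point `y ∈ E(K̄_v)` with `σ(p^a P) − p^a P − (σ y − y) ∈ E₁` for all `σ ∈ H`: the
cocycle `σ ↦ σ(p^a P) − p^a P` of `p^a • δ(p^k P)` is, modulo `E₁ ∩ E[p^k] = Fil_v`, the coboundary of `y`. (Take `S` for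
`R = p^k P`, `D = p^a P − S`, so `p^k D ∈ E₁`; divide `p^k D = p^k Z` in `E₁`; `y = D − Z`.)
[cite: GreenbergLNM1716, §2 Props. 2.1–2.2 (pp. 70–72)] [cite: SilvermanAEC2009, Props. VII.2.1–2.2] -/
theorem exists_torsion_sub_coboundary_mem_localKernelOfReduction
    (H : Subgroup (absoluteGaloisGroup (v.adicCompletion K))) {p : ℕ} (k a : ℕ)
    (hdiv₁ : ∀ D ∈ W.localKernelOfReduction v, ∃ Z ∈ W.localKernelOfReduction v, p ^ k • Z = D)
    (hdivH : ∀ R : localPoints W (v.adicCompletion K), (∀ σ ∈ H, σ • R - R ∈ W.localKernelOfReduction v) →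
      ∃ S : localPoints W (v.adicCompletion K), (∀ σ ∈ H, σ • S - S ∈ W.localKernelOfReduction v) ∧
        p ^ k • S - p ^ a • R ∈ W.localKernelOfReduction v)
    (P : localPoints W (v.adicCompletion K)) (hP : ∀ σ ∈ H, σ • (p ^ k • P) = p ^ k • P) :
    ∃ y : localPoints W (v.adicCompletion K), p ^ k • y = 0 ∧
      ∀ σ ∈ H, (σ • (p ^ a • P) - p ^ a • P) - (σ • y - y) ∈ W.localKernelOfReduction v := by
  obtain ⟨S, hS, hSR⟩ := hdivH (p ^ k • P) fun σ hσ ↦ by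
    rw [hP σ hσ, sub_self]; exact AddSubgroup.zero_mem _
  -- `D = p^a P - S` has `p^k D ∈ E₁`
  have hD : p ^ k • (p ^ a • P - S) ∈ W.localKernelOfReduction v := by
    have h : p ^ k • (p ^ a • P - S) = -(p ^ k • S - p ^ a • (p ^ k • P)) := by
      rw [smul_sub, smul_smul, smul_smul, mul_comm, neg_sub]
    rw [h]
    exact AddSubgroup.neg_mem _ hSR
  obtain ⟨Z, hZ, hZD⟩ := hdiv₁ _ hD
  refine ⟨p ^ a • P - S - Z, by rw [smul_sub, ← hZD, sub_self], fun σ hσ ↦ ?_⟩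
  have h : σ • (p ^ a • P) - p ^ a • P - (σ • (p ^ a • P - S - Z) - (p ^ a • P - S - Z)) =
      (σ • S - S) + (σ • Z - Z) := by
    rw [smul_sub, smul_sub]; abel
  rw [h]
  exact AddSubgroup.add_mem _ (hS σ hσ)
    (AddSubgroup.sub_mem _ ((W.smul_mem_localKernelOfReduction_iff v σ Z).mpr hZ) hZ)

/-! ## §3 Good reduction: the reduction map of the spectral model on `E(K̄_v)`; inertia acts trivially -/

variable {v}

/-- **`ker red = E₁(K̄_v)`**: the good-reduction homomorphism of the spectral model `W.localSpectralModel v` (unit discriminant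
at a place of good reduction), evaluated on the transport of `R ∈ E(K̄_v)`, vanishes iff `R ∈ E₁(K̄_v) = W.localKernelOfReduction v`
(both say: `R = O` or `|x(R)|_v > 1` on the minimal model). Silverman, *AEC*, Prop. VII.2.1 (exactness of
`0 → E₁ → E₀ → Ẽ_ns`). [cite: SilvermanAEC2009, Prop. VII.2.1] -/
theorem goodReductionHom_localPointsEquivSpectralModel_eq_zero_iff (hΔ : IsUnit (W.localSpectralModel v).Δ)
    (R : localPoints W (v.adicCompletion K)) :
    goodReductionHom (W.localSpectralModel v) (Valuation.integer.integers v.spectralValuation) hΔ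
        (W.localPointsEquivSpectralModel v R) = 0 ↔ R ∈ W.localKernelOfReduction v := by
  rw [goodReductionHom_eq_zero_iff]
  rfl

/-- **Inertia acts trivially on the reduction** `Ẽ(k₀)` of `E(K̄_v)` at a place of good reduction: `red (τ R) = red R` for
`τ ∈ I_{K_v}` (elements of the inertia group are `|·|_v`-isometries moving integers within their residue classes;
`reducePoint_congrEquiv_map_eq`). Silverman, *AEC*, VIII §1; Neukirch, *ANT*, II (9.3).
[cite: SilvermanAEC2009, VIII.§1 and VII.§2 (reduction and the action of inertia)] -/
theorem goodReductionHom_localPointsEquivSpectralModel_smul_of_mem_absInertia (hΔ : IsUnit (W.localSpectralModel v).Δ)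
    {τ : absoluteGaloisGroup (v.adicCompletion K)} (hτ : τ ∈ absInertia (v.adicCompletion K))
    (R : localPoints W (v.adicCompletion K)) :
    goodReductionHom (W.localSpectralModel v) (Valuation.integer.integers v.spectralValuation) hΔ
        (W.localPointsEquivSpectralModel v (τ • R)) =
      goodReductionHom (W.localSpectralModel v) (Valuation.integer.integers v.spectralValuation) hΔ
        (W.localPointsEquivSpectralModel v R) := by
  have hw := coe_spectralValuation v
  have hσ₁ : ∀ z, v.spectralValuation (((absoluteGaloisGroup.toAlgEquiv (v.adicCompletion K) τ :
      AlgebraicClosure (v.adicCompletion K) ≃ₐ[v.adicCompletion K] AlgebraicClosure (v.adicCompletion K)) :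
      AlgebraicClosure (v.adicCompletion K) →ₐ[v.adicCompletion K] AlgebraicClosure (v.adicCompletion K)) z) =
      v.spectralValuation z := fun z ↦ spectralValuation_smul hw τ z
  have hσ₂ : ∀ z, v.spectralValuation z ≤ 1 → v.spectralValuation
      (((absoluteGaloisGroup.toAlgEquiv (v.adicCompletion K) τ :
        AlgebraicClosure (v.adicCompletion K) ≃ₐ[v.adicCompletion K] AlgebraicClosure (v.adicCompletion K)) :
        AlgebraicClosure (v.adicCompletion K) →ₐ[v.adicCompletion K] AlgebraicClosure (v.adicCompletion K)) z - z) < 1 := by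
    intro z hz
    rw [mem_absInertia_iff_algNorm] at hτ
    exact (spectralValuation_lt_one_iff_algNorm_lt_one hw _).mpr
      (hτ z ((spectralValuation_le_one_iff_algNorm_le_one hw z).mp hz))
  rw [goodReductionHom_apply, goodReductionHom_apply]
  change (W.localSpectralModel v).reducePoint (Affine.Point.congrEquiv (W.localSpectralModel_baseChange v).symm
      (W.localPointsEquivModel v (τ • R))) =
    (W.localSpectralModel v).reducePoint (Affine.Point.congrEquiv (W.localSpectralModel_baseChange v).symm
      (W.localPointsEquivModel v R))
  rw [localPointsEquivModel_smul]
  exact (W.localSpectralModel v).reducePoint_congrEquiv_map_eq (W.localSpectralModel_baseChange v).symm _ hσ₁ hσ₂ _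

/-- **`τ P ≡ P (mod E₁)` for `τ` in the inertia group** at a place of good reduction: `red (τ P − P) = red (τ P) − red P = 0`.
Silverman, *AEC*, VIII §1 ("the inertia group acts trivially on `Ẽ`"). [cite: SilvermanAEC2009, VIII.§1 and Prop. VII.2.1] -/
theorem smul_sub_mem_localKernelOfReduction_of_mem_absInertia (hgood : W.HasGoodReductionAt v)
    {τ : absoluteGaloisGroup (v.adicCompletion K)} (hτ : τ ∈ absInertia (v.adicCompletion K))
    (R : localPoints W (v.adicCompletion K)) :
    τ • R - R ∈ W.localKernelOfReduction v := by
  have hΔ := W.isUnit_Δ_localSpectralModel hgood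
  rw [← W.goodReductionHom_localPointsEquivSpectralModel_eq_zero_iff hΔ, map_sub, map_sub,
    W.goodReductionHom_localPointsEquivSpectralModel_smul_of_mem_absInertia hΔ hτ, sub_self]

/-- **`Q_H ≤ Q_{τ₀}`**: if `τ₀ = h τ` with `h ∈ H` and `τ` in the inertia group, then every `R` with `σ R ≡ R (mod E₁)` for all
`σ ∈ H` also has `τ₀ R ≡ R (mod E₁)` (`E₁` is `Γ_{K_v}`-stable and inertia acts trivially modulo `E₁`).
[cite: SilvermanAEC2009, VIII.§1 and Prop. VII.2.1] [cite: GreenbergLNM1716, §2 Prop. 2.2] -/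
theorem smul_sub_mem_localKernelOfReduction_of_mul_mem (hgood : W.HasGoodReductionAt v)
    {H : Subgroup (absoluteGaloisGroup (v.adicCompletion K))} {τ₀ τ : absoluteGaloisGroup (v.adicCompletion K)}
    (hτ : τ ∈ absInertia (v.adicCompletion K)) (hτ₀ : τ₀ * τ ∈ H) (R : localPoints W (v.adicCompletion K))
    (hR : ∀ σ ∈ H, σ • R - R ∈ W.localKernelOfReduction v) :
    τ₀ • R - R ∈ W.localKernelOfReduction v := by
  -- `τ₀ R - R = (τ₀τ)(τ⁻¹ R - R) + ((τ₀τ) R - R)`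
  have hinv : τ⁻¹ • R - R ∈ W.localKernelOfReduction v :=
    W.smul_sub_mem_localKernelOfReduction_of_mem_absInertia hgood (inv_mem hτ) R
  have h1 : τ₀ • R = (τ₀ * τ) • (τ⁻¹ • R) := by rw [smul_smul, mul_assoc, mul_inv_cancel, mul_one]
  have h2 : τ₀ • R - R = (τ₀ * τ) • (τ⁻¹ • R - R) + ((τ₀ * τ) • R - R) := by rw [h1, smul_sub]; abel
  rw [h2]
  exact AddSubgroup.add_mem _ ((W.smul_mem_localKernelOfReduction_iff v _ _).mpr hinv) (hR _ hτ₀)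

/-! ## §4 Finitely many `E₁`-cosets have reduction fixed by a power of Frobenius -/

/-- **Finiteness of `Ẽ(𝔽_{q^{N₀}})`, in `E(K̄_v)`**: at a place of good reduction, for an arithmetic Frobenius `σ₀ ∈ Γ_{K_v}`
(`σ₀ z ≡ z^{q_v} (mod 𝔐)`, Mathlib `IsArithFrobAt`) and `N₀ ≥ 1`, the points `R ∈ E(K̄_v)` with `σ₀^{N₀} R ≡ R (mod E₁)` lie in
finitely many `E₁`-cosets: the reduction of such an `R` has coordinates fixed by the `q_v^{N₀}`-power map of `k₀ = 𝒪_w/𝔪_w`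
(`|σ₀^{N₀} z − z^{q^{N₀}}|_v < 1`, `spectralValuation_frobenius_pow_sub_pow_lt_one`), i.e. among the finitely many roots of
`X^{q^{N₀}} − X`, and points with the same reduction are congruent modulo `E₁ = ker red`. (Greenberg: the residue field of a
layer `K_{n,w}` is finite, so `Ẽ(k_{n,w})` is finite.) [cite: GreenbergLNM1716, §2 Props. 2.1–2.2 (finiteness of `Ẽ(k_v)`, p. 70)]
[cite: SilvermanAEC2009, Prop. VII.2.1] -/
theorem exists_finset_sub_mem_localKernelOfReduction_of_isArithFrobAt_pow [W.IsElliptic] (hgood : W.HasGoodReductionAt v)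
    {𝔐 : Ideal v.localAbsIntegers} (h𝔐 : 𝔐 ∈ v.localPrimesAbove) {σ₀ : absoluteGaloisGroup (v.adicCompletion K)}
    (hσ₀ : IsArithFrobAt (v.adicCompletionIntegers K) σ₀ 𝔐) {N₀ : ℕ} (hN₀ : 0 < N₀) :
    ∃ T : Finset (localPoints W (v.adicCompletion K)), ∀ R : localPoints W (v.adicCompletion K),
      (σ₀ ^ N₀) • R - R ∈ W.localKernelOfReduction v → ∃ t ∈ T, R - t ∈ W.localKernelOfReduction v := by
  classical
  have hw := coe_spectralValuation v
  have hvw : (v.spectralValuation).Integers (v.spectralValuation).integer := Valuation.integer.integers _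
  have hΔ := W.isUnit_Δ_localSpectralModel hgood
  haveI := isIntegral_spectralValuation_baseChange hw (W.localMinimalIntegralModel v)
  haveI hEll : ((W.localSpectralModel v).map (IsLocalRing.residue _)).IsElliptic := isElliptic_map_residue hΔ
  -- the reduction map on `E(K̄_v)`
  set red : localPoints W (v.adicCompletion K) →+ ((W.localSpectralModel v).map (IsLocalRing.residue _)).toAffine.Point :=
    (goodReductionHom (W.localSpectralModel v) hvw hΔ).comp (W.localPointsEquivSpectralModel v).toAddMonoidHom with hred
  have hker : ∀ R, red R = 0 ↔ R ∈ W.localKernelOfReduction v := fun R ↦ by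
    rw [hred, AddMonoidHom.comp_apply]
    exact W.goodReductionHom_localPointsEquivSpectralModel_eq_zero_iff hΔ R
  have hred_apply : ∀ R, red R = (W.localSpectralModel v).reducePoint
      (Affine.Point.congrEquiv (W.localSpectralModel_baseChange v).symm (W.localPointsEquivModel v R)) := fun _ ↦ rfl
  -- integral points and their reductions
  have hred_some : ∀ (R : localPoints W (v.adicCompletion K)) (x y : AlgebraicClosure (v.adicCompletion K)) (h)
      (hx : v.spectralValuation x ≤ 1), W.localPointsEquivModel v R = .some x y h →
      ∃ (hy : v.spectralValuation y ≤ 1) (hns : _),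
        red R = .some (IsLocalRing.residue (v.spectralValuation).integer ⟨x, hx⟩) (IsLocalRing.residue (v.spectralValuation).integer ⟨y, hy⟩) hns := by
    intro R x y h hx hR
    have hy : v.spectralValuation y ≤ 1 := val_y_le_one h.1 hx
    have hh : ((W.localSpectralModel v).baseChange (AlgebraicClosure (v.adicCompletion K))).toAffine.Nonsingular
        (algebraMap (v.spectralValuation).integer _ ⟨x, hx⟩) (algebraMap (v.spectralValuation).integer _ ⟨y, hy⟩) := by
      have := h; rw [← W.localSpectralModel_baseChange v] at this; exact this
    have hns : ((W.localSpectralModel v).map (IsLocalRing.residue _)).toAffine.Nonsingular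
        (IsLocalRing.residue (v.spectralValuation).integer ⟨x, hx⟩) (IsLocalRing.residue (v.spectralValuation).integer ⟨y, hy⟩) := by
      rw [← Affine.equation_iff_nonsingular]
      exact (Affine.Equation.map (IsLocalRing.residue _) ((map_equation_iff hvw.hom_inj).mp hh.1) : _)
    refine ⟨hy, hns, ?_⟩
    rw [hred_apply, hR, Affine.Point.congrEquiv_some]
    change (W.localSpectralModel v).reducePoint (.some _ _ hh) = _
    rw [reducePoint_some_algebraMap hvw.hom_inj hh]
  -- the roots of `X^{q^{N₀}} - X` in the residue field `k₀`
  set n : ℕ := Nat.card (IsLocalRing.ResidueField (v.adicCompletionIntegers K)) ^ N₀ with hn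
  have hn1 : 1 < n := Nat.one_lt_pow hN₀.ne' (two_le_natCard_residueField (K := K) (v := v))
  set Roots : Finset (IsLocalRing.ResidueField (v.spectralValuation).integer) :=
    ((X ^ n - X : (IsLocalRing.ResidueField (v.spectralValuation).integer)[X]).roots).toFinset with hRoots
  have hmemRoots : ∀ c : IsLocalRing.ResidueField (v.spectralValuation).integer, c ^ n = c → c ∈ Roots := by
    intro c hc
    have hne : (X ^ n - X : (IsLocalRing.ResidueField (v.spectralValuation).integer)[X]) ≠ 0 :=
      FiniteField.X_pow_card_sub_X_ne_zero _ hn1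
    rw [hRoots, Multiset.mem_toFinset, mem_roots hne, IsRoot.def, eval_sub, eval_pow, eval_X, hc, sub_self]
  -- residues of Frobenius-fixed integers are roots
  have hres : ∀ (x : AlgebraicClosure (v.adicCompletion K)) (hx : v.spectralValuation x ≤ 1)
      (hx' : v.spectralValuation (((absoluteGaloisGroup.toAlgEquiv (v.adicCompletion K) (σ₀ ^ N₀) :
        AlgebraicClosure (v.adicCompletion K) ≃ₐ[v.adicCompletion K] AlgebraicClosure (v.adicCompletion K)) :
        AlgebraicClosure (v.adicCompletion K) →ₐ[v.adicCompletion K] AlgebraicClosure (v.adicCompletion K)) x) ≤ 1),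
      IsLocalRing.residue (v.spectralValuation).integer ⟨_, hx'⟩ = IsLocalRing.residue (v.spectralValuation).integer ⟨x, hx⟩ → IsLocalRing.residue (v.spectralValuation).integer ⟨x, hx⟩ ∈ Roots := by
    intro x hx hx' heq
    apply hmemRoots
    have hxn : v.spectralValuation (x ^ n) ≤ 1 := by rw [map_pow]; exact pow_le_one₀ zero_le hx
    have hcong := spectralValuation_frobenius_pow_sub_pow_lt_one hw h𝔐 hσ₀ N₀ hx
    have h1 := residue_eq_of_val_sub_lt_one (w := v.spectralValuation) hxn hx' hcong
    have hpow : (⟨x, hx⟩ : (v.spectralValuation).integer) ^ n = ⟨x ^ n, hxn⟩ :=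
      Subtype.ext (SubmonoidClass.coe_pow _ _)
    calc IsLocalRing.residue (v.spectralValuation).integer ⟨x, hx⟩ ^ n
        = IsLocalRing.residue (v.spectralValuation).integer (⟨x, hx⟩ ^ n) := (map_pow _ _ _).symm
      _ = IsLocalRing.residue (v.spectralValuation).integer ⟨x ^ n, hxn⟩ := by rw [hpow]
      _ = _ := h1.symm
      _ = _ := heq
  -- the representatives
  let f : IsLocalRing.ResidueField (v.spectralValuation).integer × IsLocalRing.ResidueField (v.spectralValuation).integer →
      localPoints W (v.adicCompletion K) := fun ab ↦
    if h : ∃ (R : localPoints W (v.adicCompletion K)) (hns : _), red R = .some ab.1 ab.2 hns then h.choose else 0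
  refine ⟨insert 0 ((Roots ×ˢ Roots).image f), fun R hR ↦ ?_⟩
  have hredR : red ((σ₀ ^ N₀) • R) = red R := by
    rw [← sub_eq_zero, ← map_sub]
    exact (hker _).mpr hR
  rcases hQ : W.localPointsEquivModel v R with _ | ⟨x, y, h⟩
  · -- `R ↦ O`: `R ∈ E₁`
    refine ⟨0, Finset.mem_insert_self _ _, ?_⟩
    rw [sub_zero]
    exact W.mem_localKernelOfReduction_of_eq_zero v hQ
  by_cases hx : v.spectralValuation x ≤ 1
  · -- integral point: its residues are Frobenius-fixed
    obtain ⟨hy, hns, hredR'⟩ := hred_some R x y h hx hQ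
    have hQ' := W.localPointsEquivModel_smul v (σ₀ ^ N₀) R
    rw [hQ, Affine.Point.map_some] at hQ'
    have hx' : v.spectralValuation (((absoluteGaloisGroup.toAlgEquiv (v.adicCompletion K) (σ₀ ^ N₀) :
        AlgebraicClosure (v.adicCompletion K) ≃ₐ[v.adicCompletion K] AlgebraicClosure (v.adicCompletion K)) :
        AlgebraicClosure (v.adicCompletion K) →ₐ[v.adicCompletion K] AlgebraicClosure (v.adicCompletion K)) x) ≤ 1 := by
      exact (spectralValuation_smul hw (σ₀ ^ N₀) x).trans_le hx
    obtain ⟨hy', hns', hredσR⟩ := hred_some _ _ _ _ hx' hQ'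
    rw [hredσR, hredR'] at hredR
    simp only [Affine.Point.some.injEq] at hredR
    have hxR : IsLocalRing.residue (v.spectralValuation).integer ⟨x, hx⟩ ∈ Roots := hres x hx hx' hredR.1
    have hyR : IsLocalRing.residue (v.spectralValuation).integer ⟨y, hy⟩ ∈ Roots := hres y hy hy' hredR.2
    -- the representative of the class
    have hex : ∃ (R' : localPoints W (v.adicCompletion K)) (hns : _),
        red R' = .some (IsLocalRing.residue (v.spectralValuation).integer ⟨x, hx⟩) (IsLocalRing.residue (v.spectralValuation).integer ⟨y, hy⟩) hns := ⟨R, hns, hredR'⟩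
    refine ⟨f (IsLocalRing.residue (v.spectralValuation).integer ⟨x, hx⟩, IsLocalRing.residue (v.spectralValuation).integer ⟨y, hy⟩), Finset.mem_insert_of_mem
      (Finset.mem_image_of_mem f (Finset.mk_mem_product hxR hyR)), ?_⟩
    rw [← hker, map_sub, sub_eq_zero, hredR']
    have hf : f (IsLocalRing.residue (v.spectralValuation).integer ⟨x, hx⟩, IsLocalRing.residue (v.spectralValuation).integer ⟨y, hy⟩) = hex.choose := dif_pos hex
    rw [hf]
    obtain ⟨hns'', h''⟩ := hex.choose_spec
    rw [h'']
  · -- non-integral point: `R ∈ E₁`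
    refine ⟨0, Finset.mem_insert_self _ _, ?_⟩
    rw [sub_zero, W.mem_localKernelOfReduction_iff_of_eq_some v hQ]
    exact not_le.mp hx

end WeierstrassCurve

end
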